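import Summits.MatrixMultiplication.MatrixMultiplication.Theorems.SoloBlindHSharp

/-!
# Conjecture H♯ is not local: an E-tight rank-6 instance with an unpayable face (kernel witness)

Sub-programme (K₃) / Conjecture H♯ (`soloBlindHSharp`): for a zero-sum-free `S`, an H-good target `σ` and a
2-colouring `R ⊆ S` (the red elements), a representation `T` of `σ` (`Σ_T h = σ`) is MONOCHROMATIC when
`T ⊆ R` or `T ⊆ S \ R`; H♯ says that the good colourings pay for all (colouring, monochromatic representation)
incidences, i.e. the colourings that are good WITHOUT a monochromatic representation ("rescued") are at least as
many as the excess incidences `Σ_R (#mono(R) - 1)⁺`.  A natural LOCAL form asks for this payment inside every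
face of the colouring cube: fix the colours off a union `U = T₁ ∪ T₂` of two representations, and compare, among
the colourings of that face, the rescued ones with the excess incidences of those whose monochromatic
representations all lie inside `U`.  (Local forms of this kind hold at every instance on at most five
representations; this file shows they fail in general.)

THE WITNESS.  `S` = eleven vectors of `𝔽₃⁶` (`soloBlindLocSet`), `σ = (2,2,1,1,1,0)`.  Kernel-checked
(`decide +kernel` over the `2¹¹` subsets): `S` is zero-sum free, `σ` is H-good, the representations of `σ` are
EXACTLY the eight sets `soloBlindLocReps`, and the Kraft mass is exactly `1/2` (Conjecture E is TIGHT here, in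
rank `6`).  THE FACE.  `U = {0,1,2,3,4} = {0,3,4} ∪ {1,2,3,4}` is the union of two representations and contains
no other.  Colour everything off `U` blue and `R ⊆ U` red: for `R = U` exactly the two representations inside `U`
are monochromatic (one unit of excess), yet for EVERY `R ⊆ U` some representation is monochromatic
(`soloBlind_locFace_mono`) — the face contains no rescued colouring at all, so no face-local form of H♯ can hold.
H♯ ITSELF HOLDS HERE, WITH EQUALITY (`soloBlindLocSet_hsharp`): all `2¹¹` colourings are good — certified by a list
of 58 `𝔽₃`-combinations `1_A - 1_B` of the elements with `Σ_A h - Σ_B h = σ` (`soloBlindLocCertsRed/Blue`; every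
colouring has `A` red and `B` blue, or `A` blue and `B` red, for one of them, and such a pair exhibits the required
sub-sum, `soloBlind_subsum_of_cert`) — and `2¹¹` is exactly the incidence count `Σ_T 2^{12-|T|}`.  So the unit
of excess of the face is paid, necessarily by rescued colourings OUTSIDE the face: H♯ holds with no slack to spare,
and no face-local form of it can hold.
-/

namespace Summit.MatrixMultiplication.MatrixMultiplication.Theorems

open Finset

/-- The eleven elements of the witness, vectors of `𝔽₃⁶` (rank `6`). -/
def soloBlindLocSet : Fin 11 → (Fin 6 → ZMod 3) :=
  ![![1,1,2,0,0,2], ![0,1,1,0,0,1], ![1,0,1,0,0,1], ![2,2,1,0,1,2], ![2,2,1,1,0,2],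
    ![1,0,0,0,0,0], ![0,1,0,0,0,0], ![0,0,1,0,0,0], ![0,0,0,1,0,0], ![0,0,0,0,1,0], ![0,0,0,0,0,1]]

/-- The target `σ = (2,2,1,1,1,0)`. -/
def soloBlindLocTarget : Fin 6 → ZMod 3 := ![2,2,1,1,1,0]

/-- The eight representations of `σ`. -/
def soloBlindLocReps : Finset (Finset (Fin 11)) :=
  {{0,3,4}, {1,2,3,4}, {0,1,5,7,8,9}, {0,2,6,7,8,9}, {1,3,4,5,7,10}, {2,3,4,6,7,10}, {3,8,10}, {4,9,10}}

/-- The face support `U = {0,1,2,3,4}`, the union of the two representations `{0,3,4}` and `{1,2,3,4}`. -/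
def soloBlindLocFace : Finset (Fin 11) := {0,1,2,3,4}

/-- The witness is zero-sum free. -/
theorem soloBlindLocSet_zsf :
    ∀ T ⊆ (Finset.univ : Finset (Fin 11)), T.Nonempty → ∑ i ∈ T, soloBlindLocSet i ≠ 0 := by
  decide +kernel

/-- The target is H-good. -/
theorem soloBlindLocSet_hgood :
    ∀ T ⊆ (Finset.univ : Finset (Fin 11)),
      ∑ i ∈ T, soloBlindLocSet i ≠ soloBlindLocTarget + soloBlindLocTarget := by
  decide +kernel

/-- The representations of the target are exactly the eight listed sets. -/
theorem soloBlindLocSet_reps :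
    ∀ T ⊆ (Finset.univ : Finset (Fin 11)),
      (∑ i ∈ T, soloBlindLocSet i = soloBlindLocTarget ↔ T ∈ soloBlindLocReps) := by
  decide +kernel

/-- Conjecture E is tight at the witness: the Kraft mass is exactly `1/2`. -/
theorem soloBlindLocSet_mass :
    soloBlindMass soloBlindLocSet Finset.univ soloBlindLocTarget = 1 / 2 := by
  decide +kernel

/-- The face support is the union of two representations and contains no other representation. -/
theorem soloBlind_locFace_reps :
    soloBlindLocFace = {0,3,4} ∪ {1,2,3,4} ∧
      ∀ T ∈ soloBlindLocReps, T ⊆ soloBlindLocFace → (T = {0,3,4} ∨ T = {1,2,3,4}) := by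
  decide +kernel

/-- The top of the face (`U` red, the rest blue) has exactly two monochromatic representations
(one unit of excess incidence). -/
theorem soloBlind_locFace_top :
    ∀ T ∈ soloBlindLocReps,
      ((T ⊆ soloBlindLocFace ∨ Disjoint T soloBlindLocFace) ↔ (T = {0,3,4} ∨ T = {1,2,3,4})) := by
  decide +kernel

/-- NO COLOURING OF THE FACE IS RESCUED: for every red set `R ⊆ U` (everything off `U` blue) some
representation of `σ` is monochromatic. -/
theorem soloBlind_locFace_mono :
    ∀ R ⊆ soloBlindLocFace, ∃ T ∈ soloBlindLocReps, T ⊆ R ∨ Disjoint T R := by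
  decide +kernel

/-- RED CERTIFICATES `(A, B)`: `Σ_A h - Σ_B h = σ`; such a pair certifies every colouring with `A` red and `B` blue
(the blue side plus `σ` is then the sub-sum over `A ∪ (blue \ B)`). -/
def soloBlindLocCertsRed : List (Finset (Fin 11) × Finset (Fin 11)) :=
  [({4,9,10}, ∅), ({3,8,10}, ∅), ({0,3,4}, ∅), ({0,9}, {4,8}), ({0,8}, {3,9}), ({8,9}, {0,10}),
    ({8,9}, {1,2,10}), ({0,1,2,8,9}, {10}), ({7,8,9}, {5,6}), ({0,2,6,7,8,9}, ∅), ({0,1,5,7,8,9}, ∅),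
    ({1,2,3,4}, ∅), ({2,5,8,9}, {6,10}), ({1,6,8,9}, {5,10}), ({3,4}, {0,1,2}), ({3,7}, {4,5,6,8}),
    ({4,7}, {3,5,6,9}), ({2,4,9}, {5,7}), ({2,3,8}, {5,7}), ({2,3,4,6,7,10}, ∅), ({8,9,10}, {2,6,7}),
    ({3,4,6}, {2,5}), ({1,4,9}, {6,7}), ({1,3,8}, {6,7}), ({1,3,4,5,7,10}, ∅), ({8,9,10}, {1,5,7}),
    ({3,4,5}, {1,6}), ({0,5,6,8,9,10}, {7}), ({3,4,7,10}, {0,5,6})]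

/-- BLUE CERTIFICATES `(A, B)`: `Σ_A h - Σ_B h = σ`, certifying every colouring with `A` blue and `B` red
(the red side plus `σ` is the sub-sum over `A ∪ (red \ B)`). -/
def soloBlindLocCertsBlue : List (Finset (Fin 11) × Finset (Fin 11)) :=
  [({4,9,10}, ∅), ({3,8,10}, ∅), ({0,3,4}, ∅), ({8,9}, {0,10}), ({0,9}, {4,8}), ({0,8}, {3,9}),
    ({8,9}, {1,2,10}), ({0,1,2,8,9}, {10}), ({7,8,9}, {5,6}), ({0,2,6,7,8,9}, ∅), ({0,1,5,7,8,9}, ∅),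
    ({1,2,3,4}, ∅), ({2,5,8,9}, {6,10}), ({1,6,8,9}, {5,10}), ({3,4}, {0,1,2}), ({4,7}, {3,5,6,9}),
    ({3,7}, {4,5,6,8}), ({8,9,10}, {2,6,7}), ({3,4,6}, {2,5}), ({2,4,9}, {5,7}), ({2,3,8}, {5,7}),
    ({2,3,4,6,7,10}, ∅), ({8,9,10}, {1,5,7}), ({3,4,5}, {1,6}), ({1,4,9}, {6,7}), ({1,3,8}, {6,7}),
    ({1,3,4,5,7,10}, ∅), ({3,4,7,10}, {0,5,6}), ({0,5,6,8,9,10}, {7})]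

/-- Every red certificate satisfies its identity. -/
theorem soloBlindLocCertsRed_sound :
    ∀ c ∈ soloBlindLocCertsRed,
      ∑ i ∈ c.1, soloBlindLocSet i - ∑ i ∈ c.2, soloBlindLocSet i = soloBlindLocTarget := by
  intro c hc
  simp only [soloBlindLocCertsRed, List.mem_cons, List.mem_nil_iff, or_false] at hc
  rcases hc with rfl | rfl | rfl | rfl | rfl | rfl | rfl | rfl | rfl | rfl | rfl | rfl | rfl | rfl |
    rfl | rfl | rfl | rfl | rfl | rfl | rfl | rfl | rfl | rfl | rfl | rfl | rfl | rfl | rfl <;>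
    decide +kernel

/-- Every blue certificate satisfies its identity. -/
theorem soloBlindLocCertsBlue_sound :
    ∀ c ∈ soloBlindLocCertsBlue,
      ∑ i ∈ c.1, soloBlindLocSet i - ∑ i ∈ c.2, soloBlindLocSet i = soloBlindLocTarget := by
  intro c hc
  simp only [soloBlindLocCertsBlue, List.mem_cons, List.mem_nil_iff, or_false] at hc
  rcases hc with rfl | rfl | rfl | rfl | rfl | rfl | rfl | rfl | rfl | rfl | rfl | rfl | rfl | rfl |
    rfl | rfl | rfl | rfl | rfl | rfl | rfl | rfl | rfl | rfl | rfl | rfl | rfl | rfl | rfl <;>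
    decide +kernel

set_option maxHeartbeats 2000000 in
/-- Every colouring (red set `R`, the rest blue) is compatible with some certificate. -/
theorem soloBlindLocCerts_cover :
    ∀ R ⊆ (Finset.univ : Finset (Fin 11)),
      (∃ c ∈ soloBlindLocCertsRed, c.1 ⊆ R ∧ Disjoint c.2 R) ∨
      (∃ c ∈ soloBlindLocCertsBlue, Disjoint c.1 R ∧ c.2 ⊆ R) := by
  decide +kernel

/-- The sub-sum exhibited by a compatible certificate: if `Σ_A h - Σ_B h = σ`, `A` is disjoint from `C` and `B ⊆ C`,
then `A ∪ (C \ B)` sums to `σ + Σ_C h`. -/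
theorem soloBlind_subsum_of_cert {ι : Type*} [DecidableEq ι] {G : Type*} [AddCommGroup G] (h : ι → G)
    {A B C : Finset ι} {σ : G} (hAC : Disjoint A C) (hBC : B ⊆ C)
    (hw : ∑ i ∈ A, h i - ∑ i ∈ B, h i = σ) :
    ∑ i ∈ A ∪ (C \ B), h i = σ + ∑ i ∈ C, h i := by
  rw [Finset.sum_union (hAC.mono_right Finset.sdiff_subset), Finset.sum_sdiff_eq_sub hBC, ← hw]
  abel

/-- EVERY COLOURING OF THE WITNESS IS GOOD. -/
theorem soloBlindLocSet_allGood :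
    ∀ R ⊆ (Finset.univ : Finset (Fin 11)),
      R ∈ soloBlindGoodColourings soloBlindLocSet Finset.univ soloBlindLocTarget := by
  intro R hR
  rw [soloBlind_mem_goodColourings]
  refine ⟨hR, ?_⟩
  rcases soloBlindLocCerts_cover R hR with ⟨c, hc, hA, hB⟩ | ⟨c, hc, hA, hB⟩
  · -- `A` red, `B` blue: `σ + Σ_blue` is the sub-sum over `A ∪ (blue \ B)`
    have hBC : c.2 ⊆ Finset.univ \ R := fun x hx =>
      Finset.mem_sdiff.mpr ⟨Finset.mem_univ _, fun hxR => Finset.disjoint_left.mp hB hx hxR⟩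
    have hAC : Disjoint c.1 (Finset.univ \ R) := Finset.disjoint_sdiff.mono_left hA
    exact Or.inr ⟨c.1 ∪ ((Finset.univ \ R) \ c.2), Finset.subset_univ _,
      soloBlind_subsum_of_cert soloBlindLocSet hAC hBC (soloBlindLocCertsRed_sound c hc)⟩
  · -- `A` blue, `B` red: `σ + Σ_red` is the sub-sum over `A ∪ (red \ B)`
    exact Or.inl ⟨c.1 ∪ (R \ c.2), Finset.subset_univ _,
      soloBlind_subsum_of_cert soloBlindLocSet hA hB (soloBlindLocCertsBlue_sound c hc)⟩

/-- The incidence count `Σ_T 2^{12-|T|}` of the witness is `2048 = 2¹¹`. -/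
theorem soloBlindLocSet_incidence :
    ∑ T ∈ soloBlindSeqRepAll soloBlindLocSet Finset.univ soloBlindLocTarget,
      (2 : ℚ) ^ ((Finset.univ : Finset (Fin 11)).card + 1 - T.card) = 2048 := by
  decide +kernel

/-- CONJECTURE H♯ HOLDS AT THE WITNESS, WITH EQUALITY (`2048` good colourings, incidence count `2048`). -/
theorem soloBlindLocSet_hsharp : soloBlindHSharp soloBlindLocSet Finset.univ soloBlindLocTarget := by
  unfold soloBlindHSharp
  have hg : soloBlindGoodColourings soloBlindLocSet Finset.univ soloBlindLocTarget =
      (Finset.univ : Finset (Fin 11)).powerset := by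
    ext R
    constructor
    · intro hRg
      exact Finset.mem_powerset.mpr (soloBlind_mem_goodColourings.mp hRg).1
    · intro hRp
      exact soloBlindLocSet_allGood R (Finset.mem_powerset.mp hRp)
  rw [soloBlindLocSet_incidence, hg, Finset.card_powerset, Finset.card_univ, Fintype.card_fin]
  norm_num

/-- H♯ IS NOT LOCAL (summary).  There are a zero-sum-free `h : Fin 11 → 𝔽₃⁶`, an H-good target `τ` with
Kraft mass exactly `1/2` at which Conjecture H♯ holds, and a set `U` that is the union of two representations of `τ` and contains no
other, such that the colouring "`U` red, rest blue" has exactly two monochromatic representations while every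
colouring "`R` red, rest blue" with `R ⊆ U` has at least one: the excess incidence of the face cannot be paid
inside the face. -/
theorem soloBlind_hsharp_not_local :
    ∃ (h : Fin 11 → (Fin 6 → ZMod 3)) (τ : Fin 6 → ZMod 3) (U T₁ T₂ : Finset (Fin 11)),
      (∀ T ⊆ (Finset.univ : Finset (Fin 11)), T.Nonempty → ∑ i ∈ T, h i ≠ 0) ∧
      (∀ T ⊆ (Finset.univ : Finset (Fin 11)), ∑ i ∈ T, h i ≠ τ + τ) ∧
      soloBlindMass h Finset.univ τ = 1 / 2 ∧ soloBlindHSharp h Finset.univ τ ∧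
      T₁ ≠ T₂ ∧ U = T₁ ∪ T₂ ∧ ∑ i ∈ T₁, h i = τ ∧ ∑ i ∈ T₂, h i = τ ∧
      (∀ T ⊆ (Finset.univ : Finset (Fin 11)), ∑ i ∈ T, h i = τ →
        ((T ⊆ U ∨ Disjoint T U) ↔ (T = T₁ ∨ T = T₂))) ∧
      (∀ R ⊆ U, ∃ T ⊆ (Finset.univ : Finset (Fin 11)),
        ∑ i ∈ T, h i = τ ∧ (T ⊆ R ∨ Disjoint T R)) := by
  refine ⟨soloBlindLocSet, soloBlindLocTarget, soloBlindLocFace, {0,3,4}, {1,2,3,4},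
    soloBlindLocSet_zsf, soloBlindLocSet_hgood, soloBlindLocSet_mass, soloBlindLocSet_hsharp, by decide,
    soloBlind_locFace_reps.1, ?_, ?_, ?_, ?_⟩
  · exact (soloBlindLocSet_reps _ (Finset.subset_univ _)).2 (by decide)
  · exact (soloBlindLocSet_reps _ (Finset.subset_univ _)).2 (by decide)
  · intro T hT hsum
    exact soloBlind_locFace_top T ((soloBlindLocSet_reps T hT).1 hsum)
  · intro R hR
    obtain ⟨T, hT, hmono⟩ := soloBlind_locFace_mono R hR
    exact ⟨T, Finset.subset_univ _, (soloBlindLocSet_reps T (Finset.subset_univ _)).2 hT, hmono⟩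

end Summit.MatrixMultiplication.MatrixMultiplication.Theorems
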